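import Summits.QuantumFields.YangMills.Theorems.PoincareLipschitzWeakChainRuleShear
import Literature.Analysis.FunctionSpaces.MeyersSerrinProofs
import Literature.Analysis.FunctionSpaces.SobolevDomainNormProofs
import Mathlib.MeasureTheory.Integral.MeanInequalities
import HarnessLib

/-!
# Crux `BlockLipschitzL` (stmt-QuantumFields-23533) ∕ `HistoryTailL` (stmt-QuantumFields-19936), LINE 25 «CompactnessTransfer»,
# stub S1″ — the (TM) road, ROAD (H) «SU(2) currents ⇒ H-system», brick (Q-J) «THE WEAK JACOBIAN IDENTITY»

Cell `ym3-torus` (YM ladder rung R3 = continuum SU(2) Yang–Mills on T³ — a RUNG, NOT Clay: not d = 4, not infinite volume,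
not a mass gap); WIDTH helper seat `ym3-torus-px19` g8; `--supports stmt-QuantumFields-23533`; THEOREMS ONLY (0 `def`,
0 `sorry`, default heartbeats); imports lit ✓`MeyersSerrinProofs` (Meyers–Serrin on open sets), w2 g13's ✓`PoincareLipschitzWeakChainRuleShear` (the letter
`integrableOn_smul_of_locallyIntegrableOn`), Mathlib.

WHAT THIS FILE PROVES (generic: `E` a finite-dimensional real inner-product space with an additive Haar measure `μ`, `Ω ⊆ E`
open; scalar Sobolev functions `f, g` with weak gradients `Gf, Gg` in lit `HasWeakFDerivOn` letters):
* §1 `tendsto_eLpNorm_fderiv_of_tendsto_eSobolevDomainNorm` — `W^{1,p}` convergence ⇒ `L^p` convergence of every directional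
  derivative (the `p`-version of ✓`PoincareLipschitzSobolevChainRule.tendsto_eLpNorm_of_tendsto_eSobolevDomainNorm`).
* §2 ★ `integral_mul_jacobian_smooth` — for `f` weakly differentiable on `Ω` and `s ∈ C^∞(Ω)`:
  `∫_Ω f (∂_v s ∂_u η − ∂_u s ∂_v η) = ∫_Ω η (∂_v f ∂_u s − ∂_u f ∂_v s)` for every test function `η` on `Ω` — the weak
  derivative of `f` tested with the test functions `η ∂_v s`, `η ∂_u s` (symmetry of second derivatives of `s` kills `η ∂_u∂_v s`).
* §3 ★★★ `integral_mul_jacobian` — THE WEAK JACOBIAN IDENTITY `curl (f ∇g) = ∇f ∧ ∇g` in `D′(Ω)`: for `f, g ∈ W^{1,2}_loc(Ω)`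
  (locally square-integrable functions and weak gradients),
  `∫_Ω f (∂_v g ∂_u η − ∂_u g ∂_v η) = ∫_Ω η (∂_v f ∂_u g − ∂_u f ∂_v g)` — §2 for the Meyers–Serrin approximants `s_n → g` in
  `W^{1,2}(Ω′)` on a compactly contained neighbourhood `Ω′` of `supp η`, and `L² × L² → L¹` continuity on both sides.
This is the distributional identity behind every «div–curl» structure of sphere-valued Sobolev maps (Wente, Hélein); on this road
it turns the Maurer–Cartan identity of the `SU(2)` currents of a `W^{1,2}` map into the weak H-system (brick (Q)).
HONEST SCOPE.  Sobolev calculus only; nothing of (TM), (C), S1″, K1, `MeanDeviationL`, `BlockLipschitzL`, `HistoryTailL` is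
proved here.  YM₃ on T³ is rung R3, not Clay; YM gap NOT proved; no summit statement is proved here.

References: F. Hélein, Harmonic Maps, Conservation Laws and Moving Frames (2002) [Helein2002] (§3.1: `{a, b} = ∂_x(a ∂_y b) − ∂_y(a ∂_x b)`
in `D′` for `a, b ∈ W^{1,2}`); L. C. Evans, R. F. Gariepy (1992) [EvansGariepy1992] (§4.2); N. Meyers, J. Serrin (1964) [MeyersSerrin1964].
-/

set_option autoImplicit false

noncomputable section

open MeasureTheory Set Function Filter Topology Metric TopologicalSpace
open scoped ContDiff ENNReal BigOperators

namespace Summit.QuantumFields.YangMills.Theorems.PoincareLipschitzWeakJacobianIdentity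

open Literature.Analysis.FunctionSpaces
open Summit.QuantumFields.YangMills.Theorems.PoincareLipschitzWeakChainRuleShear (integrableOn_smul_of_locallyIntegrableOn)

variable {E : Type*} [NormedAddCommGroup E] [InnerProductSpace ℝ E] [FiniteDimensional ℝ E]
  [MeasurableSpace E] [BorelSpace E] {μ : Measure E} [μ.IsAddHaarMeasure]

/-! ## §1 From `W^{1,p}` convergence to `L^p` convergence of directional derivatives -/

/-- **`W^{1,p}` convergence controls every directional derivative in `L^p`.** [folklore] -/
theorem tendsto_eLpNorm_fderiv_of_tendsto_eSobolevDomainNorm {p : ℝ≥0∞} {Ω : Opens E} {w : E → ℝ} {Gw : E → E →L[ℝ] ℝ}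
    (hw : HasWeakFDerivOn Ω μ w Gw) {u : ℕ → E → ℝ} (hu : ∀ n, ContDiffOn ℝ ∞ (u n) (Ω : Set E))
    (hlim : Tendsto (fun n => eSobolevDomainNorm 1 p Ω μ (w - u n)) atTop (𝓝 0)) (hp : 1 ≤ p) (v : E) :
    Tendsto (fun n => eLpNorm (fun x => Gw x v - fderiv ℝ (u n) x v) p (μ.restrict (Ω : Set E))) atTop (𝓝 0) := by
  have hsub : ∀ n, HasWeakFDerivOn Ω μ (w - u n) (Gw - fderiv ℝ (u n)) :=
    fun n => hw.sub (MeyersSerrin.hasWeakFDerivOn_of_contDiffOn (μ := μ) (hu n))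
  set b := Module.finBasis ℝ E
  have hcomp : ∀ i, Tendsto (fun n => eLpNorm (fun x => (Gw x - fderiv ℝ (u n) x) (b i)) p (μ.restrict (Ω : Set E)))
      atTop (𝓝 0) := by
    intro i
    refine tendsto_of_tendsto_of_tendsto_of_le_of_le tendsto_const_nhds hlim (fun _ => bot_le) fun n => ?_
    rw [MeyersSerrin.eSobolevDomainNorm_succ_eq (hsub n)]
    refine le_trans ?_ le_add_self
    have := Finset.single_le_sum (f := fun i => eSobolevDomainNorm 0 p Ω μ (fun x => (Gw - fderiv ℝ (u n)) x (b i)))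
      (fun _ _ => bot_le) (Finset.mem_univ i)
    simpa only [eSobolevDomainNorm_zero, Pi.sub_apply] using this
  have hv : ∀ (T : E →L[ℝ] ℝ), T v = ∑ i, b.repr v i • T (b i) := fun T => by
    conv_lhs => rw [← b.sum_repr v]
    rw [map_sum]
    exact Finset.sum_congr rfl fun i _ => by rw [map_smul]
  have hle : ∀ n, eLpNorm (fun x => Gw x v - fderiv ℝ (u n) x v) p (μ.restrict (Ω : Set E)) ≤
      ∑ i, ‖b.repr v i‖ₑ * eLpNorm (fun x => (Gw x - fderiv ℝ (u n) x) (b i)) p (μ.restrict (Ω : Set E)) := by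
    intro n
    have heq : (fun x => Gw x v - fderiv ℝ (u n) x v) =
        ∑ i, (fun x => b.repr v i • (Gw x - fderiv ℝ (u n) x) (b i)) := by
      funext x
      rw [Finset.sum_apply, ← sub_apply, hv]
    rw [heq]
    refine (eLpNorm_sum_le (fun i _ => ?_) ?_).trans (Finset.sum_le_sum fun i _ => ?_)
    · exact ((hsub n).aestronglyMeasurable_deriv_apply (b i)).const_smul (b.repr v i)
    · exact hp
    · have : (fun x => b.repr v i • (Gw x - fderiv ℝ (u n) x) (b i)) =
          b.repr v i • (fun x => (Gw x - fderiv ℝ (u n) x) (b i)) := rfl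
      rw [this, eLpNorm_const_smul]
  have hlim' : Tendsto (fun n => ∑ i, ‖b.repr v i‖ₑ *
      eLpNorm (fun x => (Gw x - fderiv ℝ (u n) x) (b i)) p (μ.restrict (Ω : Set E))) atTop (𝓝 0) := by
    have : (0 : ℝ≥0∞) = ∑ i : Fin (Module.finrank ℝ E), ‖b.repr v i‖ₑ * 0 := by simp
    rw [this]
    exact tendsto_finsetSum _ fun i _ => ENNReal.Tendsto.const_mul (hcomp i) (Or.inr enorm_ne_top)
  exact tendsto_of_tendsto_of_tendsto_of_le_of_le tendsto_const_nhds hlim' (fun _ => bot_le) hle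

/-! ## §2 The identity for a smooth second factor -/

omit [FiniteDimensional ℝ E] [MeasurableSpace E] [BorelSpace E] in
/-- Gluing letter: for a test function `η` on `Ω` and `s ∈ C^∞(Ω)`, `η · ∂_v s` (with `s` arbitrary off `Ω`) is a test function
on `Ω` — near points of `Ω` a product of smooth functions, near the other points identically zero. [folklore] -/
theorem isTestFunctionOn_mul_fderiv {Ω : Opens E} {η : E → ℝ} (hη : IsTestFunctionOn Ω η)
    {s : E → ℝ} (hs : ContDiffOn ℝ ∞ s (Ω : Set E)) (v : E) :
    IsTestFunctionOn Ω fun x => η x * fderiv ℝ s x v := by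
  refine ⟨?_, hη.hasCompactSupport.mul_right, ?_⟩
  · have hs' : ContDiffOn ℝ ∞ (fun x => fderiv ℝ s x v) (Ω : Set E) :=
      (hs.fderiv_of_isOpen Ω.isOpen (by simp)).clm_apply contDiffOn_const
    rw [contDiff_iff_contDiffAt]
    intro x
    by_cases hx : x ∈ (Ω : Set E)
    · exact hη.contDiff.contDiffAt.mul (hs'.contDiffAt (Ω.isOpen.mem_nhds hx))
    · have hx' : x ∉ tsupport η := fun h => hx (hη.tsupport_subset h)
      have h0 : (fun y => η y * fderiv ℝ s y v) =ᶠ[𝓝 x] fun _ => 0 := by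
        filter_upwards [notMem_tsupport_iff_eventuallyEq.1 hx'] with y hy
        simp [hy]
      exact contDiffAt_const.congr_of_eventuallyEq h0
  · exact (tsupport_mul_subset_left (f := η) (g := fun x => fderiv ℝ s x v)).trans hη.tsupport_subset

omit [FiniteDimensional ℝ E] [MeasurableSpace E] [BorelSpace E] in
/-- Calculus letter: at a point of `Ω`, `∂_u(η ∂_v s) − ∂_v(η ∂_u s) = ∂_uη ∂_v s − ∂_vη ∂_u s` for `s ∈ C^∞(Ω)` (symmetry of
second derivatives). [folklore] -/
theorem fderiv_mul_fderiv_sub {Ω : Opens E} {η : E → ℝ} (hη : ContDiff ℝ ∞ η)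
    {s : E → ℝ} (hs : ContDiffOn ℝ ∞ s (Ω : Set E)) {x : E} (hx : x ∈ (Ω : Set E)) (u v : E) :
    fderiv ℝ (fun y => η y * fderiv ℝ s y v) x u - fderiv ℝ (fun y => η y * fderiv ℝ s y u) x v =
      fderiv ℝ η x u * fderiv ℝ s x v - fderiv ℝ η x v * fderiv ℝ s x u := by
  have hsx : ContDiffAt ℝ ∞ s x := hs.contDiffAt (Ω.isOpen.mem_nhds hx)
  have hηd : DifferentiableAt ℝ η x := hη.differentiable (by simp) x
  have hDs : DifferentiableAt ℝ (fderiv ℝ s) x :=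
    (hsx.fderiv_right (m := 1) (WithTop.coe_le_coe.mpr le_top)).differentiableAt one_ne_zero
  have hDsv : ∀ w : E, DifferentiableAt ℝ (fun y => fderiv ℝ s y w) x := fun w => hDs.clm_apply (differentiableAt_const w)
  have hd : ∀ w w' : E, fderiv ℝ (fun y => fderiv ℝ s y w) x w' = fderiv ℝ (fderiv ℝ s) x w' w := by
    intro w w'
    rw [fderiv_clm_apply hDs (differentiableAt_const w)]
    simp
  have hsymm : fderiv ℝ (fderiv ℝ s) x u v = fderiv ℝ (fderiv ℝ s) x v u :=
    hsx.isSymmSndFDerivAt (by simp only [minSmoothness_of_isRCLikeNormedField]; exact WithTop.coe_le_coe.mpr le_top) u v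
  rw [fderiv_fun_mul hηd (hDsv v), fderiv_fun_mul hηd (hDsv u)]
  simp only [add_apply, FunLike.coe_smul, Pi.smul_apply, smul_eq_mul, hd]
  rw [hsymm]
  ring

omit [FiniteDimensional ℝ E] [μ.IsAddHaarMeasure] in
/-- ★ **THE JACOBIAN IDENTITY WITH A SMOOTH SECOND FACTOR.**  `f` weakly differentiable on `Ω` (weak gradient `Gf`),
`s ∈ C^∞(Ω)`, `η` a test function on `Ω`, `u, v ∈ E`:
`∫_Ω f (∂_v s ∂_u η − ∂_u s ∂_v η) = ∫_Ω η (∂_v f ∂_u s − ∂_u f ∂_v s)` — the weak derivative of `f` tested with `η ∂_v s` and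
`η ∂_u s`. [cite: Helein2002, §3.1 (the Jacobian as a divergence)] -/
theorem integral_mul_jacobian_smooth {Ω : Opens E} {f : E → ℝ} {Gf : E → E →L[ℝ] ℝ}
    (hf : HasWeakFDerivOn Ω μ f Gf) {s : E → ℝ} (hs : ContDiffOn ℝ ∞ s (Ω : Set E))
    {η : E → ℝ} (hη : IsTestFunctionOn Ω η) (u v : E) :
    ∫ x in (Ω : Set E), f x * (fderiv ℝ s x v * fderiv ℝ η x u - fderiv ℝ s x u * fderiv ℝ η x v) ∂μ =
      ∫ x in (Ω : Set E), η x * (Gf x v * fderiv ℝ s x u - Gf x u * fderiv ℝ s x v) ∂μ := by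
  have hΩm : MeasurableSet (Ω : Set E) := Ω.isOpen.measurableSet
  -- the two test functions
  have hψ₁ := isTestFunctionOn_mul_fderiv hη hs v
  have hψ₂ := isTestFunctionOn_mul_fderiv hη hs u
  have i₁ := hf.integral_fderiv_smul_eq _ u hψ₁
  have i₂ := hf.integral_fderiv_smul_eq _ v hψ₂
  simp only [smul_eq_mul] at i₁ i₂
  -- integrability letters
  have hint : ∀ {ψ : E → ℝ}, IsTestFunctionOn Ω ψ → ∀ w : E,
      Integrable (fun x => fderiv ℝ ψ x w * f x) (μ.restrict (Ω : Set E)) := by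
    intro ψ hψ w
    have := integrableOn_smul_of_locallyIntegrableOn hf.locallyIntegrableOn
      ((hψ.contDiff.continuous_fderiv (by simp)).clm_apply continuous_const)
      (hψ.hasCompactSupport.fderiv_apply (𝕜 := ℝ) w) ((tsupport_fderiv_apply_subset ℝ w).trans hψ.tsupport_subset)
    simpa only [IntegrableOn, smul_eq_mul] using this
  have hint' : ∀ {ψ : E → ℝ}, IsTestFunctionOn Ω ψ → ∀ w : E,
      Integrable (fun x => ψ x * Gf x w) (μ.restrict (Ω : Set E)) := by
    intro ψ hψ w
    have h := integrableOn_smul_of_locallyIntegrableOn hf.locallyIntegrableOn_deriv hψ.contDiff.continuous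
      hψ.hasCompactSupport hψ.tsupport_subset
    have := (ContinuousLinearMap.apply ℝ ℝ w).integrable_comp h
    simpa [IntegrableOn, Function.comp_def, smul_eq_mul] using this
  -- left side = difference of the two tested identities
  have hL : ∫ x in (Ω : Set E), f x * (fderiv ℝ s x v * fderiv ℝ η x u - fderiv ℝ s x u * fderiv ℝ η x v) ∂μ =
      (∫ x in (Ω : Set E), fderiv ℝ (fun y => η y * fderiv ℝ s y v) x u * f x ∂μ) -
        ∫ x in (Ω : Set E), fderiv ℝ (fun y => η y * fderiv ℝ s y u) x v * f x ∂μ := by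
    rw [← integral_sub (hint hψ₁ u) (hint hψ₂ v)]
    refine setIntegral_congr_fun hΩm fun x hx => ?_
    rw [← sub_mul, fderiv_mul_fderiv_sub hη.contDiff hs hx u v]
    ring
  rw [hL, i₁, i₂, neg_sub_neg, ← integral_sub (hint' hψ₂ v) (hint' hψ₁ u)]
  refine integral_congr_ae (Filter.Eventually.of_forall fun x => ?_)
  ring

/-! ## §3 `L² × L² → L¹` letters -/

section L2

variable {α : Type*} [MeasurableSpace α] {ν : Measure α}

/-- Hölder letter: `∫ |a c| ≤ ‖a‖₂ ‖c‖₂` in `ℝ≥0∞` form. [folklore] -/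
theorem lintegral_enorm_mul_le {a c : α → ℝ} (ha : AEStronglyMeasurable a ν) (hc : AEStronglyMeasurable c ν) :
    ∫⁻ x, ‖a x * c x‖ₑ ∂ν ≤ eLpNorm a 2 ν * eLpNorm c 2 ν := by
  have h := eLpNorm_le_eLpNorm_mul_eLpNorm_of_nnnorm (p := 2) (q := 2) (r := 1) (μ := ν) ha hc
    (fun x y : ℝ => x * y) 1 (Filter.Eventually.of_forall fun x => by rw [one_mul, nnnorm_mul])
  simpa only [eLpNorm_one_eq_lintegral_enorm, ENNReal.coe_one, one_mul] using h

/-- Hölder letter: the product of two `L²` functions is integrable. [folklore] -/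
theorem integrable_mul_of_L2 {a c : α → ℝ} (ha : MemLp a 2 ν) (hc : MemLp c 2 ν) :
    Integrable (fun x => a x * c x) ν := by
  have := (MemLp.mul' (r := 1) hc ha : MemLp (fun x => a x * c x) 1 ν)
  rwa [memLp_one_iff_integrable] at this

/-- **`L² × L² → L¹` continuity of the product**: `a ∈ L²`, `b_n → b` in `L²` ⇒ `∫ a b_n → ∫ a b`, and `a b_n` is eventually
integrable. [folklore] -/
theorem tendsto_integral_mul_of_L2 {a b : α → ℝ} {bs : ℕ → α → ℝ} (ha : MemLp a 2 ν) (hb : MemLp b 2 ν)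
    (hbs : ∀ n, AEStronglyMeasurable (bs n) ν)
    (hlim : Tendsto (fun n => eLpNorm (fun x => b x - bs n x) 2 ν) atTop (𝓝 0)) :
    (∀ᶠ n in atTop, Integrable (fun x => a x * bs n x) ν) ∧
      Tendsto (fun n => ∫ x, a x * bs n x ∂ν) atTop (𝓝 (∫ x, a x * b x ∂ν)) := by
  -- eventually `bs n ∈ L²`
  have hev : ∀ᶠ n in atTop, MemLp (bs n) 2 ν := by
    have h1 : ∀ᶠ n in atTop, eLpNorm (fun x => b x - bs n x) 2 ν < 1 :=
      (tendsto_order.1 hlim).2 1 zero_lt_one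
    filter_upwards [h1] with n hn
    have hd : MemLp (fun x => b x - bs n x) 2 ν := ⟨hb.1.sub (hbs n), hn.trans ENNReal.one_lt_top⟩
    have := hb.sub hd
    refine this.congr_norm (hbs n) (Filter.Eventually.of_forall fun x => ?_)
    simp
  refine ⟨hev.mono fun n hn => integrable_mul_of_L2 ha hn, ?_⟩
  refine tendsto_integral_of_L1 _ (integrable_mul_of_L2 ha hb).aestronglyMeasurable
    (hev.mono fun n hn => integrable_mul_of_L2 ha hn) ?_
  have hle : ∀ n, ∫⁻ x, ‖a x * bs n x - a x * b x‖ₑ ∂ν ≤ eLpNorm a 2 ν * eLpNorm (fun x => b x - bs n x) 2 ν := by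
    intro n
    have h := lintegral_enorm_mul_le (ν := ν) (a := a) (c := fun x => b x - bs n x) ha.1 (hb.1.sub (hbs n))
    refine le_trans (le_of_eq (lintegral_congr fun x => ?_)) h
    rw [← enorm_neg]
    congr 1
    ring
  have h0 : Tendsto (fun n => eLpNorm a 2 ν * eLpNorm (fun x => b x - bs n x) 2 ν) atTop (𝓝 0) := by
    have := ENNReal.Tendsto.const_mul (a := eLpNorm a 2 ν) hlim (Or.inr ha.2.ne)
    simpa only [mul_zero] using this
  exact tendsto_of_tendsto_of_tendsto_of_le_of_le tendsto_const_nhds h0 (fun _ => bot_le) hle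

/-- The two-product form: `∫ (a₁ b₁ₙ − a₂ b₂ₙ) → ∫ (a₁ b₁ − a₂ b₂)`. [folklore] -/
theorem tendsto_integral_mul_sub_mul_of_L2 {a₁ a₂ b₁ b₂ : α → ℝ} {bs₁ bs₂ : ℕ → α → ℝ}
    (ha₁ : MemLp a₁ 2 ν) (ha₂ : MemLp a₂ 2 ν) (hb₁ : MemLp b₁ 2 ν) (hb₂ : MemLp b₂ 2 ν)
    (hbs₁ : ∀ n, AEStronglyMeasurable (bs₁ n) ν) (hbs₂ : ∀ n, AEStronglyMeasurable (bs₂ n) ν)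
    (hlim₁ : Tendsto (fun n => eLpNorm (fun x => b₁ x - bs₁ n x) 2 ν) atTop (𝓝 0))
    (hlim₂ : Tendsto (fun n => eLpNorm (fun x => b₂ x - bs₂ n x) 2 ν) atTop (𝓝 0)) :
    Tendsto (fun n => ∫ x, (a₁ x * bs₁ n x - a₂ x * bs₂ n x) ∂ν) atTop
      (𝓝 (∫ x, (a₁ x * b₁ x - a₂ x * b₂ x) ∂ν)) := by
  obtain ⟨hi₁, ht₁⟩ := tendsto_integral_mul_of_L2 ha₁ hb₁ hbs₁ hlim₁
  obtain ⟨hi₂, ht₂⟩ := tendsto_integral_mul_of_L2 ha₂ hb₂ hbs₂ hlim₂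
  rw [integral_sub (integrable_mul_of_L2 ha₁ hb₁) (integrable_mul_of_L2 ha₂ hb₂)]
  refine ((ht₁.sub ht₂).congr' ?_)
  filter_upwards [hi₁, hi₂] with n h1 h2
  rw [integral_sub h1 h2]

end L2

/-! ## §4 The weak Jacobian identity -/

/-- ★★★ **THE WEAK JACOBIAN IDENTITY `curl (f ∇g) = ∇f ∧ ∇g` IN `D′(Ω)`.**  For `f, g ∈ W^{1,2}_loc(Ω)` — weak gradients
`Gf, Gg` on the open set `Ω`, with `f², g², ‖Gf‖², ‖Gg‖²` locally integrable on `Ω` — every test function `η` on `Ω` and all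
directions `u, v`:
`∫_Ω f (∂_v g ∂_u η − ∂_u g ∂_v η) = ∫_Ω η (∂_v f ∂_u g − ∂_u f ∂_v g)`.
(The `f ∂_u∂_v g` terms that a formal integration by parts would produce never appear: §2 for the Meyers–Serrin
approximants of `g` in `W^{1,2}(Ω′)`, `Ω′` a compactly contained neighbourhood of `supp η`, then `L² × L² → L¹` limits on both
sides.) [cite: Helein2002, §3.1 (weak Jacobians of `W^{1,2}` maps); EvansGariepy1992, §4.2.2] -/
theorem integral_mul_jacobian {Ω : Opens E} {f g : E → ℝ} {Gf Gg : E → E →L[ℝ] ℝ}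
    (hf : HasWeakFDerivOn Ω μ f Gf) (hg : HasWeakFDerivOn Ω μ g Gg)
    (hf2 : LocallyIntegrableOn (fun x => f x ^ 2) (Ω : Set E) μ)
    (hg2 : LocallyIntegrableOn (fun x => g x ^ 2) (Ω : Set E) μ)
    (hGf2 : LocallyIntegrableOn (fun x => ‖Gf x‖ ^ 2) (Ω : Set E) μ)
    (hGg2 : LocallyIntegrableOn (fun x => ‖Gg x‖ ^ 2) (Ω : Set E) μ)
    {η : E → ℝ} (hη : IsTestFunctionOn Ω η) (u v : E) :
    ∫ x in (Ω : Set E), f x * (Gg x v * fderiv ℝ η x u - Gg x u * fderiv ℝ η x v) ∂μ =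
      ∫ x in (Ω : Set E), η x * (Gf x v * Gg x u - Gf x u * Gg x v) ∂μ := by
  -- (1) a compactly contained open neighbourhood `Ω'` of `tsupport η`
  obtain ⟨δ, hδ, hδΩ⟩ := hη.hasCompactSupport.exists_cthickening_subset_open Ω.isOpen hη.tsupport_subset
  set Ω' : Opens E := ⟨thickening δ (tsupport η), isOpen_thickening⟩ with hΩ'def
  have hΩ'K : tsupport η ⊆ (Ω' : Set E) := self_subset_thickening hδ _
  have hΩ'c : (Ω' : Set E) ⊆ cthickening δ (tsupport η) := thickening_subset_cthickening δ _
  have hKc : IsCompact (cthickening δ (tsupport η)) :=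
    isCompact_of_isClosed_isBounded isClosed_cthickening hη.hasCompactSupport.isBounded.cthickening
  have hΩ'Ω : (Ω' : Set E) ⊆ (Ω : Set E) := hΩ'c.trans hδΩ
  have hΩ'le : Ω' ≤ Ω := hΩ'Ω
  have hΩ'm : MeasurableSet (Ω' : Set E) := Ω'.isOpen.measurableSet
  have hη' : IsTestFunctionOn Ω' η := ⟨hη.contDiff, hη.hasCompactSupport, hΩ'K⟩
  have hf' : HasWeakFDerivOn Ω' μ f Gf := HasWeakFDerivOn.mono_set_holds hf hΩ'le
  have hg' : HasWeakFDerivOn Ω' μ g Gg := HasWeakFDerivOn.mono_set_holds hg hΩ'le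
  set ν := μ.restrict (Ω' : Set E) with hν
  -- (2) reduce both sides to `Ω'` (the integrands vanish off `tsupport η`)
  have hzero : ∀ x, x ∉ tsupport η → η x = 0 ∧ ∀ w, fderiv ℝ η x w = 0 := fun x hx =>
    ⟨image_eq_zero_of_notMem_tsupport hx, fun w => by rw [fderiv_of_notMem_tsupport ℝ hx]; rfl⟩
  rw [setIntegral_eq_of_subset_of_forall_sdiff_eq_zero Ω.isOpen.measurableSet hΩ'Ω fun x hx => by
      obtain ⟨-, h2⟩ := hzero x fun h => hx.2 (hΩ'K h)
      rw [h2 u, h2 v]; ring,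
    setIntegral_eq_of_subset_of_forall_sdiff_eq_zero Ω.isOpen.measurableSet hΩ'Ω
      (f := fun x => η x * (Gf x v * Gg x u - Gf x u * Gg x v)) fun x hx => by
      obtain ⟨h1, -⟩ := hzero x fun h => hx.2 (hΩ'K h)
      rw [h1]; ring]
  -- (3) `L²(Ω')` letters
  have hL2 : ∀ {h : E → ℝ}, LocallyIntegrableOn h (Ω : Set E) μ →
      LocallyIntegrableOn (fun x => h x ^ 2) (Ω : Set E) μ → MemLp h 2 ν := by
    intro h hh hh2
    have hm : AEStronglyMeasurable h ν :=
      ((hh.integrableOn_compact_subset hδΩ hKc).mono_set hΩ'c).aestronglyMeasurable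
    exact (memLp_two_iff_integrable_sq hm).2 ((hh2.integrableOn_compact_subset hδΩ hKc).mono_set hΩ'c)
  have hGL2 : ∀ {h : E → ℝ} {G : E → E →L[ℝ] ℝ}, HasWeakFDerivOn Ω μ h G →
      LocallyIntegrableOn (fun x => ‖G x‖ ^ 2) (Ω : Set E) μ → ∀ w : E, MemLp (fun x => G x w) 2 ν := by
    intro h G hh hG2 w
    have hm : AEStronglyMeasurable G ν :=
      ((hh.locallyIntegrableOn_deriv.integrableOn_compact_subset hδΩ hKc).mono_set hΩ'c).aestronglyMeasurable
    have hG : MemLp G 2 ν :=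
      (memLp_two_iff_integrable_sq_norm hm).2 ((hG2.integrableOn_compact_subset hδΩ hKc).mono_set hΩ'c)
    exact (ContinuousLinearMap.apply ℝ ℝ w).comp_memLp' hG
  have hfL2 : MemLp f 2 ν := hL2 hf.locallyIntegrableOn hf2
  have hGfL2 : ∀ w, MemLp (fun x => Gf x w) 2 ν := hGL2 hf hGf2
  have hGgL2 : ∀ w, MemLp (fun x => Gg x w) 2 ν := hGL2 hg hGg2
  -- bounded continuous compactly supported factors are in `L^∞(Ω')`
  have hηc : Continuous η := hη.contDiff.continuous
  have hη'c : ∀ w, Continuous fun x => fderiv ℝ η x w :=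
    fun w => (hη.contDiff.continuous_fderiv (by simp)).clm_apply continuous_const
  have hηtop : MemLp η ∞ ν := by
    obtain ⟨M, hM⟩ := hη.hasCompactSupport.exists_bound_of_continuous hηc
    exact memLp_top_of_bound hηc.aestronglyMeasurable M (Filter.Eventually.of_forall hM)
  have hη'top : ∀ w, MemLp (fun x => fderiv ℝ η x w) ∞ ν := by
    intro w
    obtain ⟨M, hM⟩ := (hη.hasCompactSupport.fderiv_apply (𝕜 := ℝ) w).exists_bound_of_continuous (hη'c w)
    exact memLp_top_of_bound (hη'c w).aestronglyMeasurable M (Filter.Eventually.of_forall hM)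
  -- (4) `g ∈ W^{1,2}(Ω')` and its Meyers–Serrin approximants
  have hmem : MemSobolevDomain 1 2 Ω' μ g := by
    rw [memSobolevDomain_succ_iff]
    refine ⟨hL2 hg.locallyIntegrableOn hg2, Gg, hg', fun w => ?_⟩
    rw [memSobolevDomain_zero_iff]
    exact hGgL2 w
  obtain ⟨s, hs, hlim⟩ := MeyersSerrin.exists_contDiffOn_tendsto_eSobolevDomainNorm_sub (Ω := Ω') (μ := μ)
    (p := 2) (by norm_num) ENNReal.ofNat_ne_top hmem
  have hD : ∀ w, Tendsto (fun n => eLpNorm (fun x => Gg x w - fderiv ℝ (s n) x w) 2 ν) atTop (𝓝 0) :=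
    fun w => tendsto_eLpNorm_fderiv_of_tendsto_eSobolevDomainNorm hg' hs hlim (by norm_num) w
  have hsm : ∀ n w, AEStronglyMeasurable (fun x => fderiv ℝ (s n) x w) ν := fun n w =>
    (((hs n).continuousOn_fderiv_of_isOpen Ω'.isOpen (by simp)).clm_apply continuousOn_const)
      |>.aestronglyMeasurable hΩ'm
  -- (5) §2 for each approximant
  have idn : ∀ n, ∫ x in (Ω' : Set E), f x * (fderiv ℝ (s n) x v * fderiv ℝ η x u - fderiv ℝ (s n) x u * fderiv ℝ η x v) ∂μ =
      ∫ x in (Ω' : Set E), η x * (Gf x v * fderiv ℝ (s n) x u - Gf x u * fderiv ℝ (s n) x v) ∂μ :=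
    fun n => integral_mul_jacobian_smooth hf' (hs n) hη' u v
  -- (6) the two limits
  have hA := tendsto_integral_mul_sub_mul_of_L2 (ν := ν)
    (a₁ := fun x => f x * fderiv ℝ η x u) (a₂ := fun x => f x * fderiv ℝ η x v)
    (b₁ := fun x => Gg x v) (b₂ := fun x => Gg x u)
    (bs₁ := fun n x => fderiv ℝ (s n) x v) (bs₂ := fun n x => fderiv ℝ (s n) x u)
    (MemLp.mul' (r := 2) (hη'top u) hfL2) (MemLp.mul' (r := 2) (hη'top v) hfL2) (hGgL2 v) (hGgL2 u)
    (fun n => hsm n v) (fun n => hsm n u) (hD v) (hD u)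
  have hB := tendsto_integral_mul_sub_mul_of_L2 (ν := ν)
    (a₁ := fun x => η x * Gf x v) (a₂ := fun x => η x * Gf x u)
    (b₁ := fun x => Gg x u) (b₂ := fun x => Gg x v)
    (bs₁ := fun n x => fderiv ℝ (s n) x u) (bs₂ := fun n x => fderiv ℝ (s n) x v)
    (MemLp.mul' (r := 2) (hGfL2 v) hηtop) (MemLp.mul' (r := 2) (hGfL2 u) hηtop) (hGgL2 u) (hGgL2 v)
    (fun n => hsm n u) (fun n => hsm n v) (hD u) (hD v)
  have hAB : (fun n => ∫ x, ((fun x => f x * fderiv ℝ η x u) x * (fun n x => fderiv ℝ (s n) x v) n x -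
      (fun x => f x * fderiv ℝ η x v) x * (fun n x => fderiv ℝ (s n) x u) n x) ∂ν) =
      fun n => ∫ x, ((fun x => η x * Gf x v) x * (fun n x => fderiv ℝ (s n) x u) n x -
      (fun x => η x * Gf x u) x * (fun n x => fderiv ℝ (s n) x v) n x) ∂ν := by
    funext n
    have h1 := idn n
    rw [hν]
    refine Eq.trans ?_ (h1.trans ?_)
    · refine integral_congr_ae (Filter.Eventually.of_forall fun x => ?_)
      simp only
      ring
    · refine integral_congr_ae (Filter.Eventually.of_forall fun x => ?_)
      simp only
      ring
  rw [hAB] at hA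
  have hlimeq := tendsto_nhds_unique hA hB
  -- (7) conclude
  refine Eq.trans ?_ (hlimeq.trans ?_)
  · refine integral_congr_ae (Filter.Eventually.of_forall fun x => ?_)
    simp only
    ring
  · refine integral_congr_ae (Filter.Eventually.of_forall fun x => ?_)
    simp only
    ring

end Summit.QuantumFields.YangMills.Theorems.PoincareLipschitzWeakJacobianIdentity
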